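import Summits.QuantumFields.BalabanUV.T4Continuum.Spine.NE1p.DressedResponseTorusWitness

/-!
# T⁴ programme, spine estimate NE1′ (node O3b/H2) — THE (2.14)-SHAPE AND BIRTHS TORUS FACES FIRE ON A TWO-ATOM EXPONENTIAL PENCIL
# (crew WITNESS row «THE RESPONSE, (2.14)-SHAPE AND JOINT-ANALYTICITY TORUS FACES FIRE», PART 2 of 2)

Cell `pub-balaban`, sub-cell `t4`, BINDER-OWNERS row NE1′ (owner lineage t4-ne1p-p1); NE1′ formalisation crew seat
`b2b-balaban-t4-ne1p-formalise-leaf-06` (LEAF PROVER 06, generation 9).  ADDITIVE — imports PART 1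
`Spine/NE1p/DressedResponseTorusWitness` ONLY (⇒ S25, S24, W24, N0j–N0o, pv22); toy DATA defs only (the exponential pencil `expAct`
and its two-atom (2.14)-representation letters `terms₂`∕`pre₂`∕`lin₂`∕`l₂`∕`ν₂`), 0 `def … : Prop`, 0 cite, 0 sorry; nothing of
S24 ∕ W24 ∕ N0k ∕ N0l is restated — their declarations are used BY NAME.

WHY THIS FILE.  The two remaining unexercised crew torus ENDs of PART 1's census — S24 §2 `muPart_locE_le_of_rep_torus` (N0k's
(2.14)-SHAPE END `muPart_locE_le_of_rep` on the carrier) and `muPart_locE_le_of_births_torus` (N0l's BIRTHS END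
`muPart_locE_le_of_births` on the carrier) — need an activity that IS a finite sum of averaged exp-linear terms read along a table.
W24's linear pencil `s·c` is not of that shape; the EXPONENTIAL pencil `H_s(Z) = 𝟙[Z = X₀]·c·(e^s − 1)` is, with TWO atoms on the
one-point parameter space: `c·e^{1·s}·δ + (−c)·e^{0·s}·δ` (read-outs `id` and `0` on the table space `Pot := ℂ`, table `V := id`).
* §4 the datum and its letters; `hrep₂` — (B1) `hrep` IS A THEOREM for the toy (`integral_dirac`, `Fintype.sum_bool`); `mass₂` —
  the representation's mass at table radius `ρ` is `|c|·(e^ρ + 1)` on the cube, `0` elsewhere; `hL3₂` — with `c := A∕(e^ρ + 1)` the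
  (2.38)-shape holds with EQUALITY on the cube (`torusTreeLen_singleton`); `repFace_fires_torus` — S24 `muPart_locE_le_of_rep_torus`
  ONCE BY NAME (`R₀ := μ₁`, `c := A⋆∕(e^{μ₁} + 1)`; closed form `K₀(64,8)·μ₀∕(μ₁ − μ₀)`); `birthsFace_fires_torus` — S24
  `muPart_locE_le_of_births_torus` ONCE BY NAME, the same pencil read as a family of births (`V₀ := 0`, `ε₁ := 0`, birth map
  `T := id`, `t := 1`, dressing `Dμ := id` of size `D₀ := μ₁`, history radius `w := μ₁ + 1` so that `hw : 1·μ₁ < μ₁ + 1`,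
  `c := A⋆∕(e^{0 + (μ₁ + 1)} + 1)` — the face's own radius letter `ε₁ + w` kept LITERAL).
* GENUINE: `expAct_live` — for `0 < c`, `c·(e^{‖μ‖} + 1) < 1`, `0 < ‖μ‖ < 2π` the output MOVES off the source origin
  (`exp_locE_cube`: `1 + c·(e^μ − 1) ≠ 1` since `e^μ ≠ 1`, `Complex.exp_eq_one_iff`); `repFace_live_torus` — at the face's own letters.

HONEST FRAMING.  A WITNESS over hypothesis SHAPES: two crew torus FACES applied once each BY NAME on a decided two-atom exponential
pencil on pv22's CONSTRUCTED carrier; (B1) `hrep` inhabited by a decided two-atom table — NOT Bałaban's (2.14); every (B3) `hL3`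
toy-true BY CHOICE of the toy constant ((B3) = GAPS G-ne9p2-5, UNPRINTED — untouched); N0l's births ∕ map binders inhabited by
identity maps and located radii — nothing of [Balaban1988RGII]'s births performed; (B5)'s clauses at pv22's numerals; 0 binders
instantiated on Bałaban's densities ∕ minimisers ∕ backgrounds; discharges no wall item; the wall line v1.6 does NOT move; R-t4r2-Q2
NOT met thereby; NE1′ ⇐ the named binders — NOT printed, NOT proved; spine PROVED 0∕9; count 9 unchanged.  Printed loci
([Balaban1988RGII] (2.14) p. 15, (2.18) p. 16, (2.38) p. 20; Lemma 1 (1.33) p. 10) are TYPE ∕ CONTEXT through the imported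
[cite]-tagged Literature modules, re-asserted nowhere; ABSOLUTE RULE honoured ([folklore] kernel lemmas only).  Rung (B)+1 on ONE
finite four-torus — NOT infinite volume, NOT a mass gap, NOT OS on ℝ⁴, NOT Clay.  HONEST DEPENDENCY: continuum YM on T⁴ ⇐ BetaPertH ∧
nine spine estimates (0/9 proved); BetaPertH ⇐ (D1) ∧ (D4) ∧ CAP+tail; G-an2-4 gates asym, D1 and NE2/3/4.
-/

noncomputable section

namespace Summit.QuantumFields.BalabanUV.T4Continuum.NE1p.DressedRepresentationTorusWitness

open Metric Set Complex MeasureTheory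
open Literature.MathematicalPhysics.QuantumFieldTheory.Balaban1983to89.B12TreeDecay (K₀ K₀_pos)
open Literature.MathematicalPhysics.QuantumFieldTheory.Balaban1983to89.B13Resummation (locE)
open Literature.MathematicalPhysics.QuantumFieldTheory.Balaban1983to89.TreeLengthTorus (TPt TDom tsys torusTreeLen
  torusTreeLen_singleton)
open Literature.MathematicalPhysics.QuantumFieldTheory.Balaban1983to89.TreeLengthTorusGeometry (TTouch)
open Summit.QuantumFields.BalabanUV.T4Continuum.NE1p.DressedSmallFieldGeometryFaces (muPart_locE_le_of_rep_torus
  muPart_locE_le_of_births_torus)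
open Summit.QuantumFields.BalabanUV.T4Continuum.NE1p.DressedSmallFieldTorusWitness (X₀ X₀_val hrate_torus_num
  dressedConst_le_one exp_locE_cube)
open Summit.QuantumFields.BalabanUV.T4Continuum.NE1p.DressedResponseTorusWitness (hsmall_num Astar_pos envelope_closed)

variable (N : ℕ) [NeZero N]

/-! ## §4 THE (2.14)-SHAPE AND BIRTHS FACES FIRE — S24 `muPart_locE_le_of_rep_torus` ∕ `muPart_locE_le_of_births_torus` on a decided
two-atom EXPONENTIAL pencil `H_s(Z) = 𝟙[Z = X₀]·c·(e^s − 1) = ∫ c·e^{1·s} dδ + ∫ (−c)·e^{0·s} dδ` -/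

/-- THE EXPONENTIAL ACTIVITY PENCIL (toy DATA): `H_s(Z) = c·(e^s − 1)` on the one-cube domain, `0` elsewhere. [folklore] -/
def expAct (c : ℝ) (s : ℂ) (Z : TDom 4 N) : ℂ := if Z.1 = {0} then c * (cexp s - 1) else 0

/-- The exponential pencil on `X₀`. [folklore] -/
@[simp] theorem expAct_X₀ (c : ℝ) (s : ℂ) : expAct N c s (X₀ N) = c * (cexp s - 1) := if_pos rfl

/-- At the origin of the source the exponential pencil is the zero activity. [folklore] -/
@[simp] theorem expAct_zero (c : ℝ) (Z : TDom 4 N) : expAct N c 0 Z = 0 := by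
  unfold expAct; split_ifs <;> simp

omit [NeZero N] in
/-- THE TERM INDEX of the two-atom representation (toy DATA): both atoms on the one-cube domain, none elsewhere. [folklore] -/
def terms₂ (Z : TDom 4 N) : Finset Bool := if Z.1 = {0} then Finset.univ else ∅

/-- THE PREFACTORS of the two atoms (toy DATA): `c` for the atom `e^{1·s}`, `−c` for the atom `e^{0·s}`. [folklore] -/
def pre₂ (c : ℝ) (j : Bool) (_ : Unit) : ℂ := cond j (c : ℂ) (-(c : ℂ))

/-- THE READ-OUTS of the two atoms (toy DATA; `Pot := ℂ`): the identity for the live atom, `0` for the constant atom. [folklore] -/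
def lin₂ (j : Bool) (_ : Unit) : ℂ →L[ℂ] ℂ := cond j (ContinuousLinearMap.id ℂ ℂ) 0

/-- THE READ-OUT NORM LETTERS (toy DATA): `1` and `0`. [folklore] -/
def l₂ (j : Bool) (_ : Unit) : ℝ := cond j 1 0

/-- THE REFERENCE MEASURES of the atoms (toy DATA): the Dirac mass on the one-point parameter space. [folklore] -/
def ν₂ (_ : Bool) : Measure Unit := Measure.dirac ()

/-- The read-out norms are the letters: `‖lin₂ j ω‖ ≤ l₂ j ω`. [folklore] -/
theorem norm_lin₂_le : ∀ (j : Bool) (ω : Unit), ‖lin₂ j ω‖ ≤ l₂ j ω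
  | false, _ => by simp [lin₂, l₂]
  | true, _ => ContinuousLinearMap.norm_id_le

/-- **(B1) `hrep` IS A THEOREM FOR THE TOY**: the exponential pencil IS the two-atom (2.14)-SHAPE sum along the table `V s`
(`integral_dirac`, `Fintype.sum_bool`). [folklore] -/
theorem hrep₂ (c : ℝ) (s : ℂ) (Z : TDom 4 N) :
    expAct N c s Z = ∑ j ∈ terms₂ N Z, ∫ ω, pre₂ c j ω * cexp (lin₂ j ω s) ∂(ν₂ j) := by
  unfold expAct terms₂
  split_ifs
  · rw [Fintype.sum_bool]
    simp only [ν₂, integral_dirac, pre₂, lin₂, cond_true, cond_false, ContinuousLinearMap.coe_id', id,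
      _root_.zero_apply, Complex.exp_zero]
    ring
  · simp

/-- THE MASS OF THE REPRESENTATION at table radius `ρ`: `Σ_j ∫‖pre_j‖·e^{l_j·ρ} = |c|·(e^ρ + 1)` on the one-cube domain, `0` elsewhere.
[folklore] -/
theorem mass₂ (c ρ : ℝ) (Z : TDom 4 N) :
    ∑ j ∈ terms₂ N Z, ∫ ω, ‖pre₂ c j ω‖ * Real.exp (l₂ j ω * ρ) ∂(ν₂ j) = if Z.1 = {0} then |c| * (Real.exp ρ + 1) else 0 := by
  unfold terms₂
  split_ifs
  · rw [Fintype.sum_bool]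
    simp only [ν₂, integral_dirac, pre₂, l₂, cond_true, cond_false, norm_neg, Complex.norm_real, Real.norm_eq_abs, one_mul,
      zero_mul, Real.exp_zero]
    ring
  · simp

/-- **THE (2.38)-SHAPE OF THE MASS, TIGHT**: with the toy constant `c := A∕(e^ρ + 1)` the mass on the one-cube domain is EXACTLY `A`
(`= A·e^{−R·0}` by `torusTreeLen_singleton`), and `0 ≤ A·e^{−R d(Z)}` elsewhere. [folklore] -/
theorem hL3₂ {A : ℝ} (hA : 0 ≤ A) (ρ R : ℝ) (X : (tsys 4 N).Dom) :
    ∀ Z : (tsys 4 N).Dom, Z.1 ⊆ X.1 →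
      ∑ j ∈ terms₂ N Z, ∫ ω, ‖pre₂ (A / (Real.exp ρ + 1)) j ω‖ * Real.exp (l₂ j ω * ρ) ∂(ν₂ j) ≤
        A * Real.exp (-(R * torusTreeLen Z.1)) := by
  intro Z _
  rw [mass₂]
  split_ifs with h
  · have hd : torusTreeLen Z.1 = 0 := by rw [h]; exact torusTreeLen_singleton 0
    have he : 0 < Real.exp ρ + 1 := by positivity
    rw [hd, mul_zero, neg_zero, Real.exp_zero, mul_one, abs_of_nonneg (div_nonneg hA he.le), div_mul_cancel₀ _ he.ne']
  · positivity

variable {N} in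
/-- Integrability socket: on the one-point parameter space every density is integrable. [folklore] -/
theorem hint₂ (c ρ : ℝ) (j : Bool) : Integrable (fun ω => ‖pre₂ c j ω‖ * Real.exp (l₂ j ω * ρ)) (ν₂ j) := by
  unfold pre₂ l₂ ν₂; exact integrable_const _

open Classical in
/-- **S24 `muPart_locE_le_of_rep_torus` FIRES** (N0k's (2.14)-SHAPE END on the carrier, BY NAME, once): table `V := id` on the source disc
`‖s‖ < μ₁` (`Pot := ℂ`, table radius `R₀ := μ₁`), the two-atom representation of §4 with `c := A⋆∕(e^{μ₁} + 1)` ((2.38)-shape TIGHT on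
the cube), `r₁ = 0`, `R = 2·(64·log 162) + 2`; for `‖μ‖ ≤ μ₀ < μ₁`:
`‖E_{H_μ}({0}) − E_{H_0}({0})‖ ≤ e·9·64·K₀(64,8)²·A⋆·e⁰·μ₀∕(μ₁ − μ₀)`. [folklore] -/
theorem repFace_fires_torus {μ₁ μ₀ : ℝ} {μ : ℂ} (h0 : 0 < μ₀) (h01 : μ₀ < μ₁) (hμ : ‖μ‖ ≤ μ₀) :
    ‖locE (TTouch (d := 4) (N := N)) (fun Z : (tsys 4 N).Dom => Z.1)
          (expAct N ((Real.exp 1 * K₀ 64 8 * 9 * 64)⁻¹ / (Real.exp μ₁ + 1)) μ) (X₀ N).1 -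
        locE (TTouch (d := 4) (N := N)) (fun Z : (tsys 4 N).Dom => Z.1)
          (expAct N ((Real.exp 1 * K₀ 64 8 * 9 * 64)⁻¹ / (Real.exp μ₁ + 1)) 0) (X₀ N).1‖ ≤
      Real.exp 1 * 9 * 64 * K₀ 64 8 ^ 2 * (Real.exp 1 * K₀ 64 8 * 9 * 64)⁻¹ * Real.exp (-(0 * torusTreeLen (X₀ N).1)) *
        (μ₀ / (μ₁ - μ₀)) :=
  muPart_locE_le_of_rep_torus (X₀ N) (ν' := ν₂) (pre := pre₂ ((Real.exp 1 * K₀ 64 8 * 9 * 64)⁻¹ / (Real.exp μ₁ + 1)))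
    (lin := lin₂) (l := l₂) (R₀ := μ₁) (V := fun s : ℂ => s) (terms := terms₂ N) (R := 2 * (64 * Real.log 162) + 2)
    Astar_pos.le le_rfl hrate_torus_num (hsmall_num le_rfl) (fun s _ Z => hrep₂ N _ s Z)
    (fun _ => aestronglyMeasurable_const) (fun _ _ => by unfold lin₂; exact aestronglyMeasurable_const) norm_lin₂_le (hint₂ _ μ₁)
    differentiableOn_id (Set.mapsTo_id _) (hL3₂ N Astar_pos.le μ₁ _ (X₀ N)) h0 h01 hμ

open Classical in
/-- **S24 `muPart_locE_le_of_births_torus` FIRES** (N0l's BIRTHS END on the carrier, BY NAME, once): the same pencil read as a family of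
births — undressed table `V₀ := 0` (`ε₁ := 0`), birth map `T := id : ℂ →L[ℂ] ℂ` (`t := 1`), dressing `Dμ := id` of size `D₀ := μ₁` on
the disc, history radius `w := μ₁ + 1` (`hw : 1·μ₁ < μ₁ + 1`), representation constant `c := A⋆∕(e^{0 + (μ₁+1)} + 1)` ((2.38)-shape
TIGHT at the history radius). [folklore] -/
theorem birthsFace_fires_torus {μ₁ μ₀ : ℝ} {μ : ℂ} (h0 : 0 < μ₀) (h01 : μ₀ < μ₁) (hμ : ‖μ‖ ≤ μ₀) :
    ‖locE (TTouch (d := 4) (N := N)) (fun Z : (tsys 4 N).Dom => Z.1)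
          (expAct N ((Real.exp 1 * K₀ 64 8 * 9 * 64)⁻¹ / (Real.exp (0 + (μ₁ + 1)) + 1)) μ) (X₀ N).1 -
        locE (TTouch (d := 4) (N := N)) (fun Z : (tsys 4 N).Dom => Z.1)
          (expAct N ((Real.exp 1 * K₀ 64 8 * 9 * 64)⁻¹ / (Real.exp (0 + (μ₁ + 1)) + 1)) 0) (X₀ N).1‖ ≤
      Real.exp 1 * 9 * 64 * K₀ 64 8 ^ 2 * (Real.exp 1 * K₀ 64 8 * 9 * 64)⁻¹ * Real.exp (-(0 * torusTreeLen (X₀ N).1)) *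
        (μ₀ / (μ₁ - μ₀)) :=
  muPart_locE_le_of_births_torus (X₀ N) (ν' := ν₂)
    (pre := pre₂ ((Real.exp 1 * K₀ 64 8 * 9 * 64)⁻¹ / (Real.exp (0 + (μ₁ + 1)) + 1))) (lin := lin₂) (l := l₂)
    (T := ContinuousLinearMap.id ℂ ℂ) (Dμ := fun s : ℂ => s) (V₀ := 0) (terms := terms₂ N) (R := 2 * (64 * Real.log 162) + 2)
    (ε₁ := 0) (D₀ := μ₁) (t := 1) (w := μ₁ + 1) Astar_pos.le le_rfl hrate_torus_num (hsmall_num le_rfl)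
    (fun s _ Z => by simp only [ContinuousLinearMap.coe_id', id, zero_add]; exact hrep₂ N _ s Z)
    (fun _ => aestronglyMeasurable_const) (fun _ _ => by unfold lin₂; exact aestronglyMeasurable_const) norm_lin₂_le
    (hint₂ _ _) differentiableOn_id (fun _ hs => (mem_ball_zero_iff.1 hs).le) (by rw [norm_zero])
    ContinuousLinearMap.norm_id_le (by linarith) (hL3₂ N Astar_pos.le _ _ (X₀ N)) h0 h01 hμ

open Classical in
/-- CLOSED FORM of both §4 bounds: `K₀(64,8)·μ₀∕(μ₁ − μ₀)`. [folklore] -/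
theorem repFace_fires_torus' {μ₁ μ₀ : ℝ} {μ : ℂ} (h0 : 0 < μ₀) (h01 : μ₀ < μ₁) (hμ : ‖μ‖ ≤ μ₀) :
    ‖locE (TTouch (d := 4) (N := N)) (fun Z : (tsys 4 N).Dom => Z.1)
          (expAct N ((Real.exp 1 * K₀ 64 8 * 9 * 64)⁻¹ / (Real.exp μ₁ + 1)) μ) (X₀ N).1 -
        locE (TTouch (d := 4) (N := N)) (fun Z : (tsys 4 N).Dom => Z.1)
          (expAct N ((Real.exp 1 * K₀ 64 8 * 9 * 64)⁻¹ / (Real.exp μ₁ + 1)) 0) (X₀ N).1‖ ≤ K₀ 64 8 * (μ₀ / (μ₁ - μ₀)) := by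
  have h := repFace_fires_torus N h0 h01 hμ
  rwa [envelope_closed] at h

/-! ### GENUINE: the exponential pencil's output MOVES off the source origin -/

open Classical in
/-- **GENUINE — THE (2.14)-SHAPE TOY OUTPUT IS NOT CONSTANT**: for `0 < c`, `c·(e^{‖μ‖} + 1) < 1`, `0 < ‖μ‖ < 2π`:
`E_{H_μ}({0}) ≠ E_{H_0}({0})` (exponentials `1 + c·(e^μ − 1) ≠ 1` since `e^μ ≠ 1` — `Complex.exp_eq_one_iff`). [folklore] -/
theorem expAct_live {c : ℝ} (hc : 0 < c) {μ : ℂ} (hcμ : c * (Real.exp ‖μ‖ + 1) < 1) (hne : μ ≠ 0)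
    (h2π : ‖μ‖ < 2 * Real.pi) :
    locE (TTouch (d := 4) (N := N)) (fun Z : (tsys 4 N).Dom => Z.1) (expAct N c μ) (X₀ N).1 ≠
      locE (TTouch (d := 4) (N := N)) (fun Z : (tsys 4 N).Dom => Z.1) (expAct N c 0) (X₀ N).1 := by
  intro heq
  have hn : ‖expAct N c μ (X₀ N)‖ < 1 := by
    rw [expAct_X₀, norm_mul, Complex.norm_real, Real.norm_eq_abs, abs_of_pos hc]
    have h1 : ‖cexp μ - 1‖ ≤ Real.exp ‖μ‖ + 1 :=
      calc ‖cexp μ - 1‖ ≤ ‖cexp μ‖ + ‖(1 : ℂ)‖ := norm_sub_le _ _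
        _ = Real.exp μ.re + 1 := by rw [Complex.norm_exp, norm_one]
        _ ≤ Real.exp ‖μ‖ + 1 := by gcongr; exact Complex.re_le_norm μ
    calc c * ‖cexp μ - 1‖ ≤ c * (Real.exp ‖μ‖ + 1) := mul_le_mul_of_nonneg_left h1 hc.le
      _ < 1 := hcμ
  have h0 : ‖expAct N c 0 (X₀ N)‖ < 1 := by rw [expAct_zero, norm_zero]; exact one_pos
  have h1 := exp_locE_cube N hn
  rw [X₀_val] at heq
  rw [heq, exp_locE_cube N h0, expAct_zero, expAct_X₀] at h1
  have hz : cexp μ = 1 := by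
    have hcne : (c : ℂ) ≠ 0 := by exact_mod_cast hc.ne'
    have : (c : ℂ) * (cexp μ - 1) = 0 := by linear_combination -h1
    simpa [hcne, sub_eq_zero] using this
  obtain ⟨n, hn'⟩ := Complex.exp_eq_one_iff.1 hz
  have hnorm : ‖μ‖ = |(n : ℝ)| * (2 * Real.pi) := by
    rw [hn', norm_mul, Complex.norm_intCast, show (2 * ↑Real.pi * I : ℂ) = ((2 * Real.pi : ℝ) : ℂ) * I by push_cast; ring,
      norm_mul, Complex.norm_real, Complex.norm_I, mul_one, Real.norm_eq_abs, abs_of_pos Real.two_pi_pos]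
  have hn0 : n = 0 := by
    by_contra h
    have h1le : (1 : ℝ) ≤ |(n : ℝ)| := by exact_mod_cast Int.one_le_abs h
    have : 2 * Real.pi ≤ ‖μ‖ := by rw [hnorm]; nlinarith [Real.two_pi_pos]
    linarith
  rw [hn0] at hn'
  exact hne (by simpa using hn')

open Classical in
/-- **GENUINE AT THE FACE'S OWN LETTERS**: the quantity bounded by `repFace_fires_torus` is `≠ 0` for every source `μ ≠ 0` with
`‖μ‖ ≤ μ₀ < μ₁` and `‖μ‖ < 2π` (`c·(e^{‖μ‖} + 1) < c·(e^{μ₁} + 1) = A⋆ ≤ 1`). [folklore] -/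
theorem repFace_live_torus {μ₁ μ₀ : ℝ} {μ : ℂ} (h01 : μ₀ < μ₁) (hμ : ‖μ‖ ≤ μ₀) (hne : μ ≠ 0) (h2π : ‖μ‖ < 2 * Real.pi) :
    locE (TTouch (d := 4) (N := N)) (fun Z : (tsys 4 N).Dom => Z.1)
        (expAct N ((Real.exp 1 * K₀ 64 8 * 9 * 64)⁻¹ / (Real.exp μ₁ + 1)) μ) (X₀ N).1 ≠
      locE (TTouch (d := 4) (N := N)) (fun Z : (tsys 4 N).Dom => Z.1)
        (expAct N ((Real.exp 1 * K₀ 64 8 * 9 * 64)⁻¹ / (Real.exp μ₁ + 1)) 0) (X₀ N).1 := by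
  have he : 0 < Real.exp μ₁ + 1 := by positivity
  refine expAct_live N (div_pos Astar_pos he) ?_ hne h2π
  calc (Real.exp 1 * K₀ 64 8 * 9 * 64)⁻¹ / (Real.exp μ₁ + 1) * (Real.exp ‖μ‖ + 1) <
        (Real.exp 1 * K₀ 64 8 * 9 * 64)⁻¹ / (Real.exp μ₁ + 1) * (Real.exp μ₁ + 1) := by
        gcongr (Real.exp 1 * K₀ 64 8 * 9 * 64)⁻¹ / (Real.exp μ₁ + 1) * (?_ + 1)
        · exact div_pos Astar_pos he
        · exact Real.exp_lt_exp.2 (lt_of_le_of_lt hμ h01)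
    _ = (Real.exp 1 * K₀ 64 8 * 9 * 64)⁻¹ := div_mul_cancel₀ _ he.ne'
    _ ≤ 1 := dressedConst_le_one

end Summit.QuantumFields.BalabanUV.T4Continuum.NE1p.DressedRepresentationTorusWitness

end
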